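import Summits.QuantumFields.QCD.Theorems.NestedDissectionSeaCoerciveSeaChiralForcesCrossing

/-!
# Crux `CoerciveSea` (stmt-QuantumFields-13901), line `chirality-collapses-pseudospectrum`, stub A″ —
# the STIELTJES REDUCTION: a chiral pile-up is a pile-up of cell CROSSINGS near the valence mass
# (or meets a non-chiral window vector, or the cell crosses at the mass itself)

Helper file of lead-1. Combines the landed four-sign crossing theorem
(`ChiralForcesCrossing.chiral_member_forces_crossing_or_nonchiral`, p100546) member by member over the
A″ event of stub 4 / 4′ (`stub_chiralPileupRareOfPinned` / `stub_chiralPileupRareLarge`): a family of pencil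
eigenvectors `D_c(μ) u_j = ev_j · Γ_c u_j` (`D_c(μ) = wilsonCell U μ 0 s`) with `|ev_j| < 2τ`, weights
`0 ≤ wgt_j`, `wgt_j |ev_j| ≤ 1`, and sheet-weighted pile-up `Σ_j wgt_j f(u_j) > 1/(4τ)`
(`f(u) = Σ_{p ∉ childrenInterior s} ‖u_p‖²`) forces ONE of:

* (a) `det D_c(μ) = 0` — the cell crosses AT the valence mass (a null event under the measure);
* (b) for some member `j`, at some mass `μ'` with `|μ' − μ| ≤ |ev_j|/χ₀`, a pencil eigenvector `v ≠ 0` of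
  `D_c(μ')` with eigenvalue `c` of the sign of `ev_j`, `|c| ≤ |ev_j| < 2τ`, whose chirality in the direction
  `σ` of `χ(u_j)` is below the cut: `σ · re χ(v) < χ₀ Σ‖v_p‖²` (the fine-level non-chiral / pair sector);
* (c) crossings `det D_c(μ*_j) = 0`, one per member, with `0 < |μ*_j − μ| ≤ |ev_j|/χ₀ < 2τ/χ₀`, whose
  SHEET-WEIGHTED STIELTJES PILE-UP exceeds the threshold: `Σ_j f(u_j) / (χ₀ |μ*_j − μ|) > 1/(4τ)`
  (`wgt_j ≤ 1/|ev_j| ≤ 1/(χ₀|μ*_j − μ|)`).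

So the A″-law (k-uniform `P(A″_t) ≤ C t^α` at `τ = t/s₀`) follows from a NEAR-CROSSING DENSITY law for the
Dirichlet cell at the valence mass (crossings within `2t/(χ₀ s₀)`, weighted by the sheet fractions of the
modes that announce them) plus the fine-level non-chiral law — `EarlyCrosserLaw` made quantitative one
resolution finer (FINDINGS-lead-1.md §3). Deterministic; the chirality cut of the members is not even needed
for the trichotomy (it is what makes (b) a RARE event). [folklore]
-/

noncomputable section

open scoped BigOperators ComplexConjugate
open Matrix Literature.MathematicalPhysics.QuantumLattice Literature.MathematicalPhysics.QuantumFieldTheory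
  Literature.Probability.LatticeModels

namespace Summit.QuantumFields.QCD.Cruxes.CoerciveSea.ChiralityCollapsesPseudospectrum

namespace ChiralForcesCrossing

/-- A vector with `Σ_p conj(u_p) u_p = 1` is non-zero. [folklore] -/
theorem ne_zero_of_sum_star_mul_self_eq_one {ι : Type*} [Fintype ι] {u : ι → ℂ}
    (h : ∑ p, star (u p) * u p = 1) : u ≠ 0 := by
  rintro rfl
  simp at h

/-- A pencil eigenvector with eigenvalue `0` is a kernel vector, so the cell determinant vanishes. [folklore] -/
theorem det_wilsonCell_eq_zero_of_ev_zero {N : ℕ} [NeZero N]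
    (U : GaugeConfig 4 N (Matrix.specialUnitaryGroup (Fin 3) ℂ)) (μ : ℝ) (s : Fin 4 → ℕ)
    (u : {p // wilsonBox (0 : TorusSite 4 N) s p} → ℂ) (hu0 : u ≠ 0)
    (heig : (wilsonCell U μ 0 s).mulVec u = fun p => ((0 : ℝ) : ℂ) * gammaFive p.1.2.2 p.1.2.2 * u p) :
    (wilsonCell U μ 0 s).det = 0 := by
  refine Matrix.exists_mulVec_eq_zero_iff.1 ⟨u, hu0, ?_⟩
  rw [heig]
  funext p
  simp

/-- **Stieltjes reduction of the chiral pile-up (trichotomy).** See the module docstring: for a family of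
pencil eigenvectors of `wilsonCell U μ 0 s` with `Σ_p conj(u_j p) u_j p = 1`, eigenvalues `|ev_j| < 2τ`,
weights `0 ≤ wgt_j`, `wgt_j|ev_j| ≤ 1` and sheet-weighted pile-up `> 1/(4τ)`, and any cut `0 < χ₀ ≤ 1`:
(a) `det D_c(μ) = 0`, or (b) a directed-non-chiral window vector near the mass for some member, or
(c) one crossing per member within `|ev_j|/χ₀` with Stieltjes pile-up `Σ_j f_j/(χ₀|μ*_j − μ|) > 1/(4τ)`.
Registered sub-goal of stub 4 (`chiralPileup_stieltjes_trichotomy`). [folklore] -/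
theorem chiralPileup_stieltjes_trichotomy :
    ∀ (N : ℕ) [NeZero N] (U : GaugeConfig 4 N (Matrix.specialUnitaryGroup (Fin 3) ℂ))
      (s : Fin 4 → ℕ) (μ τ χ₀ : ℝ) (n : ℕ) (u : Fin n → ({p // wilsonBox (0 : TorusSite 4 N) s p} → ℂ))
      (ev wgt : Fin n → ℝ), 0 < τ → 0 < χ₀ → χ₀ ≤ 1 →
      (∀ j, ∑ p, star (u j p) * u j p = 1) →
      (∀ j, (wilsonCell U μ 0 s).mulVec (u j) = fun p => (ev j : ℂ) * gammaFive p.1.2.2 p.1.2.2 * u j p) →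
      (∀ j, |ev j| < 2 * τ ∧ 0 ≤ wgt j ∧ wgt j * |ev j| ≤ 1) →
      1 / (4 * τ) < ∑ j, wgt j * ∑ p, (if childrenInterior s p then (0 : ℝ) else ‖u j p‖ ^ 2) →
      (wilsonCell U μ 0 s).det = 0 ∨
      (∃ j : Fin n, ∃ μ' : ℝ, |μ' - μ| ≤ |ev j| / χ₀ ∧ ∃ σ : ℝ, (σ = 1 ∨ σ = -1) ∧
          0 ≤ σ * (∑ p, star (u j p) * gammaFive p.1.2.2 p.1.2.2 * u j p).re ∧
          ∃ v : {p // wilsonBox (0 : TorusSite 4 N) s p} → ℂ, v ≠ 0 ∧ ∃ c : ℝ,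
            ((wilsonCell U μ' 0 s).mulVec v = fun p => (c : ℂ) * gammaFive p.1.2.2 p.1.2.2 * v p) ∧
            0 < c * ev j ∧ |c| ≤ |ev j| ∧
            σ * (∑ p, star (v p) * gammaFive p.1.2.2 p.1.2.2 * v p).re < χ₀ * ∑ p, ‖v p‖ ^ 2) ∨
      (∃ μs : Fin n → ℝ, (∀ j, (wilsonCell U (μs j) 0 s).det = 0 ∧ 0 < |μs j - μ| ∧
          |μs j - μ| ≤ |ev j| / χ₀) ∧
        1 / (4 * τ) < ∑ j, (∑ p, (if childrenInterior s p then (0 : ℝ) else ‖u j p‖ ^ 2)) /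
          (χ₀ * |μs j - μ|)) := by
  intro N _ U s μ τ χ₀ n u ev wgt hτ hχ₀ hχ₁ hunit heig hbd hpile
  classical
  by_cases hdet : (wilsonCell U μ 0 s).det = 0
  · exact Or.inl hdet
  right
  have hu0 : ∀ j, u j ≠ 0 := fun j => ne_zero_of_sum_star_mul_self_eq_one (hunit j)
  -- every member has `ev_j ≠ 0` (else the cell crosses at `μ`)
  have hev0 : ∀ j, ev j ≠ 0 := by
    intro j hj
    refine hdet (det_wilsonCell_eq_zero_of_ev_zero U μ s (u j) (hu0 j) ?_)
    rw [heig j, hj]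
  -- directions per member
  set σ : Fin n → ℝ := fun j =>
    if 0 ≤ (∑ p, star (u j p) * gammaFive p.1.2.2 p.1.2.2 * u j p).re then 1 else -1 with hσdef
  set τs : Fin n → ℝ := fun j => if 0 ≤ ev j then 1 else -1 with hτsdef
  have hσ : ∀ j, σ j = 1 ∨ σ j = -1 := fun j => by
    simp only [hσdef]; split_ifs <;> simp
  have hσnn : ∀ j, 0 ≤ σ j * (∑ p, star (u j p) * gammaFive p.1.2.2 p.1.2.2 * u j p).re := fun j => by
    simp only [hσdef]
    split_ifs with h
    · simpa using h
    · push Not at h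
      nlinarith
  have hτs : ∀ j, τs j = 1 ∨ τs j = -1 := fun j => by
    simp only [hτsdef]; split_ifs <;> simp
  have hτev : ∀ j, 0 < τs j * ev j := fun j => by
    simp only [hτsdef]
    split_ifs with h
    · have := lt_of_le_of_ne h (Ne.symm (hev0 j)); simpa using this
    · push Not at h; nlinarith
  have habs : ∀ j, τs j * ev j = |ev j| := fun j => by
    simp only [hτsdef]
    split_ifs with h
    · rw [one_mul, abs_of_nonneg h]
    · push Not at h; rw [neg_one_mul, abs_of_neg h]
  -- the four-sign theorem, member by member
  have key : ∀ j, ∃ x : ℝ, 0 ≤ x ∧ x ≤ |ev j| / χ₀ ∧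
      ((wilsonCell U (μ - σ j * τs j * x) 0 s).det = 0 ∨
        ∃ v : {p // wilsonBox (0 : TorusSite 4 N) s p} → ℂ, v ≠ 0 ∧ ∃ c : ℝ,
          ((wilsonCell U (μ - σ j * τs j * x) 0 s).mulVec v =
              fun p => (c : ℂ) * gammaFive p.1.2.2 p.1.2.2 * v p) ∧
          0 < τs j * c ∧ τs j * c ≤ τs j * ev j ∧
          σ j * (∑ p, star (v p) * gammaFive p.1.2.2 p.1.2.2 * v p).re < χ₀ * ∑ p, ‖v p‖ ^ 2) := by
    intro j
    obtain ⟨x, hx0, hx1, halt⟩ := chiral_member_forces_crossing_or_nonchiral N U s μ (u j) (ev j) χ₀ (σ j)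
      (τs j) (hu0 j) (heig j) hχ₀ hχ₁ (hσ j) (hτs j) (hτev j)
    refine ⟨x, hx0, ?_, halt⟩
    rwa [habs j] at hx1
  -- either some member meets a non-chiral window vector …
  by_cases hNC : ∃ j, ∃ x : ℝ, 0 ≤ x ∧ x ≤ |ev j| / χ₀ ∧
      ∃ v : {p // wilsonBox (0 : TorusSite 4 N) s p} → ℂ, v ≠ 0 ∧ ∃ c : ℝ,
        ((wilsonCell U (μ - σ j * τs j * x) 0 s).mulVec v =
            fun p => (c : ℂ) * gammaFive p.1.2.2 p.1.2.2 * v p) ∧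
        0 < τs j * c ∧ τs j * c ≤ τs j * ev j ∧
        σ j * (∑ p, star (v p) * gammaFive p.1.2.2 p.1.2.2 * v p).re < χ₀ * ∑ p, ‖v p‖ ^ 2
  · left
    obtain ⟨j, x, hx0, hx1, v, hv0, c, hv, hc1, hc2, hform⟩ := hNC
    have hστ1 : |σ j * τs j| = 1 := by
      rcases hσ j with h | h <;> rcases hτs j with h' | h' <;> rw [h, h'] <;> norm_num
    refine ⟨j, μ - σ j * τs j * x, ?_, σ j, hσ j, hσnn j, v, hv0, c, hv, ?_, ?_, hform⟩
    · have : μ - σ j * τs j * x - μ = -(σ j * τs j * x) := by ring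
      rw [this, abs_neg, abs_mul, hστ1, one_mul, abs_of_nonneg hx0]
      exact hx1
    · have hτ2 : τs j * τs j = 1 := by rcases hτs j with h | h <;> rw [h] <;> norm_num
      nlinarith [hτev j]
    · have hcabs : |c| = τs j * c := by
        rcases hτs j with h | h
        · rw [h, one_mul] at hc1 ⊢; exact abs_of_pos hc1
        · rw [h, neg_one_mul] at hc1 ⊢; exact abs_of_neg (by linarith)
      rw [hcabs, ← habs j]
      exact hc2
  -- … or every member forces a crossing: the Stieltjes pile-up
  · right
    push Not at hNC
    have hcross : ∀ j, ∃ x : ℝ, 0 < x ∧ x ≤ |ev j| / χ₀ ∧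
        (wilsonCell U (μ - σ j * τs j * x) 0 s).det = 0 := by
      intro j
      obtain ⟨x, hx0, hx1, halt⟩ := key j
      rcases halt with hd | ⟨v, hv0, c, hv, hc1, hc2, hform⟩
      · refine ⟨x, lt_of_le_of_ne hx0 ?_, hx1, hd⟩
        rintro rfl
        simp only [mul_zero, sub_zero] at hd
        exact hdet hd
      · exact absurd hform (not_lt.2 (hNC j x hx0 hx1 v hv0 c hv hc1 hc2))
    choose x hxpos hxle hxdet using hcross
    have hστ1 : ∀ j, |σ j * τs j| = 1 := fun j => by
      rcases hσ j with h | h <;> rcases hτs j with h' | h' <;> rw [h, h'] <;> norm_num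
    have hdist : ∀ j, |μ - σ j * τs j * x j - μ| = x j := fun j => by
      have : μ - σ j * τs j * x j - μ = -(σ j * τs j * x j) := by ring
      rw [this, abs_neg, abs_mul, hστ1, one_mul, abs_of_pos (hxpos j)]
    refine ⟨fun j => μ - σ j * τs j * x j, fun j => ⟨hxdet j, ?_, ?_⟩, ?_⟩
    · rw [hdist]; exact hxpos j
    · rw [hdist]; exact hxle j
    · refine lt_of_lt_of_le hpile (Finset.sum_le_sum fun j _ => ?_)
      rw [hdist]
      have hf : 0 ≤ ∑ p, (if childrenInterior s p then (0 : ℝ) else ‖u j p‖ ^ 2) :=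
        Finset.sum_nonneg fun p _ => by split_ifs <;> positivity
      -- `wgt_j ≤ 1/|ev_j| ≤ 1/(χ₀ x_j)`
      have hevpos : 0 < |ev j| := abs_pos.2 (hev0 j)
      have hw : wgt j ≤ 1 / (χ₀ * x j) := by
        have h1 : wgt j ≤ 1 / |ev j| := by
          rw [le_div_iff₀ hevpos]; exact (hbd j).2.2
        have h2 : χ₀ * x j ≤ |ev j| := by
          have := hxle j
          rwa [le_div_iff₀ hχ₀, mul_comm] at this
        have h3 : 1 / |ev j| ≤ 1 / (χ₀ * x j) :=
          one_div_le_one_div_of_le (mul_pos hχ₀ (hxpos j)) h2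
        exact h1.trans h3
      rw [div_eq_mul_one_div, mul_comm _ (1 / (χ₀ * x j))]
      exact mul_le_mul_of_nonneg_right hw hf

end ChiralForcesCrossing

end Summit.QuantumFields.QCD.Cruxes.CoerciveSea.ChiralityCollapsesPseudospectrum

end
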